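import Literature.AnabelianGeometry.EtaleTheta.Discharge.Sec1Prop18
import HarnessLib

/-!
# [EtTh] §1, Prop. 1.8, the `Ẋ`-case: the cusp characterisation of `Ẋ → Ċ` made intrinsic

Mochizuki, *The étale theta function …*, Publ. RIMS **45** (2009), §1, Prop. 1.8, PRIMS PDF pp. 28–29
(printed 254–255) [cite: MochizukiEtTh2009, Prop 1.8 p.28]. Layer L2 of the abc-iut cell, seat
abc-iut-L2-t1. PROOF-ONLY refinement (no `def`) of `Discharge/Sec1Prop18.lean`.

There, the `Ẋ`-case `prop18_of_extension` took input (c) in the RELATIONAL form `Γ(Π^tp_{Ċα}) = Π^tp_{Ċβ}`.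
Print (p. 28) obtains it from an INTRINSIC characterisation of each configuration plus an anabelian
fact: "since `Ẋ^log → Ċ^log` may be characterized as the quotient by the unique automorphism of `Ẋ^log`
over `C^log` that acts nontrivially on the cusps of `Ẋ^log` [where we recall that `γ` preserves
decomposition groups of cusps — cf. [SemiAnbd] Theorem 6.5, (iii)] but does not lie over `X^log`".
This file carries that out:
* the cusps of `Ẋ` are read through the tree's cusp data of `X` (`TemperedCurve.IsCuspidalDecompositionGroup`
  on `Π^tp_X`, layer L3): an element `g ∈ Π^tp_C` *acts trivially on the cusps of `Ẋ`* iff for every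
  cuspidal decomposition group `D ⊆ Π^tp_X` the `g`-conjugate of `D ∩ Π^tp_Ẋ` (inside `Π^tp_C`) is a
  `Π^tp_Ẋ`-conjugate of it — written INLINE below (no new definition);
* `fixesCuspsOfDotX_of_map` — this property is TRANSPORTED by `Γ` whenever `Γ` is compatible with an
  isomorphism `γX : Π^tp_{Xα} →̃ Π^tp_{Xβ}` preserving cuspidal decomposition groups ([SemiAnbd] Thm. 6.5 (iii),
  the tree's named fact `TemperedCurve.IsoPreservesCuspidalDecomp`, taken as a hypothesis) and
  `Γ(Π^tp_{Ẋα}) = Π^tp_{Ẋβ}` (which the extension clause gives, `map_dotX_eq_of_extension`);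
* `map_dotC_eq_of_separating` — if on EACH side "`Π^tp_Ċ ∖ Π^tp_Ẋ` = the elements not over `X` acting
  nontrivially on the cusps of `Ẋ`" (print's sentence, an intrinsic property of the configuration of
  Def. 1.7), then any `Γ` preserving `Π^tp_X`, `Π^tp_Ẋ` and transporting the cusp action carries `Π^tp_{Ċα}`
  onto `Π^tp_{Ċβ}` (inclusion by the characterisation, equality by `[Π^tp_C : Π^tp_Ċ] = 2`);
* `prop18_of_cusps` — **Prop. 1.8, `Ẋ`-case, modulo**: (a) the K-core extension `Γ` of `γ`
  ([SemiAnbd] 6.8 (ii) + (II)), (b) the induced `γX` ([AbsCusp] 2.1 (v)), (c′) the intrinsic cusp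
  characterisation of `Ċ` on both sides + [SemiAnbd] Thm. 6.5 (iii) for `(Xα, Xβ)`, (d) Thm. 1.6 (i).
HONEST FRAMING: typed ≠ proved for the anabelian inputs; nothing here asserts Prop. 1.8; no side taken.
-/

namespace Literature.AnabelianGeometry.EtaleTheta

open Literature.AnabelianGeometry.SemiGraphs

variable {p : ℕ} [Fact p.Prime]

section Prop18Cusps

variable {Mα Mβ : MuTwoSetting p} {εα : Mα.GtpC} {εβ : Mβ.GtpC}

/-- Compatibility `inclX ∘ γX = Γ ∘ inclX` and `Γ(Π^tp_{Ẋα}) = Π^tp_{Ẋβ}` give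
`γX(Π^tp_{Xα} ∩ Π^tp_{Ẋα}) = Π^tp_{Xβ} ∩ Π^tp_{Ẋβ}` (pull-backs to `Π^tp_X`). [cite: MochizukiEtTh2009, Prop 1.8 p.28] -/
theorem map_comap_dotX_eq (Γ : Mα.GtpC ≃ₜ* Mβ.GtpC) (γX : Mα.PiTemp ≃ₜ* Mβ.PiTemp)
    (hγX : ∀ x, Mβ.inclX (γX.toMulEquiv x) = Γ.toMulEquiv (Mα.inclX x))
    (hdotX : (Mα.dotX εα).map Γ.toMulEquiv.toMonoidHom = Mβ.dotX εβ) :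
    ((Mα.dotX εα).comap Mα.inclX).map γX.toMulEquiv.toMonoidHom = (Mβ.dotX εβ).comap Mβ.inclX := by
  ext y
  constructor
  · rintro ⟨x, hx, rfl⟩
    have hx' : Mα.inclX x ∈ Mα.dotX εα := Subgroup.mem_comap.1 hx
    show Mβ.inclX (γX.toMulEquiv x) ∈ Mβ.dotX εβ
    rw [hγX, ← hdotX]
    exact ⟨Mα.inclX x, hx', rfl⟩
  · intro hy
    have hy' : Mβ.inclX y ∈ Mβ.dotX εβ := Subgroup.mem_comap.1 hy
    refine ⟨γX.toMulEquiv.symm y, ?_, by simp⟩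
    show Mα.inclX (γX.toMulEquiv.symm y) ∈ Mα.dotX εα
    rw [← hdotX] at hy'
    obtain ⟨z, hz, hzy⟩ := hy'
    have : Γ.toMulEquiv (Mα.inclX (γX.toMulEquiv.symm y)) = Γ.toMulEquiv z := by
      rw [← hγX, MulEquiv.apply_symm_apply]
      exact hzy.symm
    rw [Γ.toMulEquiv.injective this]
    exact hz

/-- **[SemiAnbd] Thm. 6.5 (iii) transports the action on the cusps of `Ẋ`** (p. 28 "we recall that `γ`
preserves decomposition group[s] of cusps"): if `Γ g` acts trivially on the cusps of `Ẋβ`, then `g`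
acts trivially on the cusps of `Ẋα` — for `Γ` compatible with a cusp-preserving `γX` and
`Γ(Π^tp_{Ẋα}) = Π^tp_{Ẋβ}`. [cite: MochizukiEtTh2009, Prop 1.8 p.28] -/
theorem fixesCuspsOfDotX_of_map (Γ : Mα.GtpC ≃ₜ* Mβ.GtpC) (γX : Mα.PiTemp ≃ₜ* Mβ.PiTemp)
    (hγX : ∀ x, Mβ.inclX (γX.toMulEquiv x) = Γ.toMulEquiv (Mα.inclX x))
    (hdotX : (Mα.dotX εα).map Γ.toMulEquiv.toMonoidHom = Mβ.dotX εβ)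
    (hcusp : TemperedCurve.IsoPreservesCuspidalDecomp Mα.toTemperedCurve Mβ.toTemperedCurve)
    (g : Mα.GtpC)
    (hfix : ∀ D' : Subgroup Mβ.PiTemp, Mβ.IsCuspidalDecompositionGroup D' →
      ∃ h' ∈ Mβ.dotX εβ,
        ((D' ⊓ (Mβ.dotX εβ).comap Mβ.inclX).map Mβ.inclX).map
            (MulAut.conj (Γ.toMulEquiv g)).toMonoidHom =
          ((D' ⊓ (Mβ.dotX εβ).comap Mβ.inclX).map Mβ.inclX).map (MulAut.conj h').toMonoidHom) :
    ∀ D : Subgroup Mα.PiTemp, Mα.IsCuspidalDecompositionGroup D →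
      ∃ h ∈ Mα.dotX εα,
        ((D ⊓ (Mα.dotX εα).comap Mα.inclX).map Mα.inclX).map (MulAut.conj g).toMonoidHom =
          ((D ⊓ (Mα.dotX εα).comap Mα.inclX).map Mα.inclX).map (MulAut.conj h).toMonoidHom := by
  intro D hD
  -- the corresponding cusp of `Xβ`
  have hD' : Mβ.IsCuspidalDecompositionGroup (D.map γX.toMulEquiv.toMonoidHom) := (hcusp γX D).1 hD
  obtain ⟨h', hh', heq⟩ := hfix _ hD'
  rw [← hdotX] at hh'
  obtain ⟨h, hh, rfl⟩ := hh'
  refine ⟨h, hh, ?_⟩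
  -- `Γ` of the `α`-side subgroup is the `β`-side subgroup
  have hkey : ((D.map γX.toMulEquiv.toMonoidHom ⊓ (Mβ.dotX εβ).comap Mβ.inclX).map Mβ.inclX) =
      ((D ⊓ (Mα.dotX εα).comap Mα.inclX).map Mα.inclX).map Γ.toMulEquiv.toMonoidHom := by
    rw [← map_comap_dotX_eq Γ γX hγX hdotX, ← Subgroup.map_inf_eq _ _ _ γX.toMulEquiv.injective,
      map_map_inclX_eq Γ γX hγX]
  -- conjugation commutes with `Γ`
  have hconj : ∀ c : Mα.GtpC,
      (MulAut.conj (Γ.toMulEquiv c)).toMonoidHom.comp Γ.toMulEquiv.toMonoidHom =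
        Γ.toMulEquiv.toMonoidHom.comp (MulAut.conj c).toMonoidHom := by
    intro c
    ext x
    simp only [MonoidHom.coe_comp, Function.comp_apply, MulEquiv.coe_toMonoidHom, MulAut.conj_apply,
      map_mul, map_inv]
  rw [hkey] at heq
  generalize (D ⊓ (Mα.dotX εα).comap Mα.inclX).map Mα.inclX = S at heq ⊢
  have hswap : ∀ c : Mα.GtpC, (S.map (MulAut.conj c).toMonoidHom).map Γ.toMulEquiv.toMonoidHom =
      (S.map Γ.toMulEquiv.toMonoidHom).map (MulAut.conj (Γ.toMulEquiv c)).toMonoidHom := by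
    intro c
    rw [Subgroup.map_map, Subgroup.map_map, hconj c]
  apply Subgroup.map_injective (f := Γ.toMulEquiv.toMonoidHom) fun a b hab => Γ.toMulEquiv.injective hab
  rw [hswap g, hswap h]
  exact heq

/-- **The cusp characterisation of `Ẋ → Ċ` pins `Γ(Π^tp_Ċ)`**: if on each side an element NOT lying over
`X` belongs to `Π^tp_Ċ` iff it does NOT have property `P` (print, p. 28: `P` = "acts trivially on the
cusps of `Ẋ`"), `P` is reflected by `Γ`, and `Γ` preserves `Π^tp_X` and `Π^tp_Ẋ`, then
`Γ(Π^tp_{Ċα}) = Π^tp_{Ċβ}` (`⊆` by the characterisation and `Π^tp_Ċ ∩ Π^tp_X = Π^tp_Ẋ`; `=` by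
`[Π^tp_C : Π^tp_Ċ] = 2`). [cite: MochizukiEtTh2009, Prop 1.8 p.28] -/
theorem map_dotC_eq_of_separating (hα : Mα.IsAdmissibleEpsZ εα) (hβ : Mβ.IsAdmissibleEpsZ εβ)
    (Γ : Mα.GtpC ≃ₜ* Mβ.GtpC)
    (hX : Mα.inclX.range.map Γ.toMulEquiv.toMonoidHom = Mβ.inclX.range)
    (hdotX : (Mα.dotX εα).map Γ.toMulEquiv.toMonoidHom = Mβ.dotX εβ)
    (Pα : Mα.GtpC → Prop) (Pβ : Mβ.GtpC → Prop) (hP : ∀ g, Pβ (Γ.toMulEquiv g) → Pα g)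
    (hcα : ∀ g, g ∉ Mα.inclX.range → (g ∈ Mα.dotC εα ↔ ¬ Pα g))
    (hcβ : ∀ g, g ∉ Mβ.inclX.range → (g ∈ Mβ.dotC εβ ↔ ¬ Pβ g)) :
    (Mα.dotC εα).map Γ.toMulEquiv.toMonoidHom = Mβ.dotC εβ := by
  -- inclusion
  have hle : (Mα.dotC εα).map Γ.toMulEquiv.toMonoidHom ≤ Mβ.dotC εβ := by
    rintro _ ⟨g, hg, rfl⟩
    change Γ.toMulEquiv g ∈ Mβ.dotC εβ
    by_cases hgX : g ∈ Mα.dotX εα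
    · apply Mβ.dotX_le_dotC εβ
      rw [← hdotX]
      exact ⟨g, hgX, rfl⟩
    · have hgX' : g ∉ Mα.inclX.range := by
        intro h
        apply hgX
        rw [← Mα.dotC_inf_range hα]
        exact Subgroup.mem_inf.2 ⟨hg, h⟩
      have hnP : ¬ Pα g := (hcα g hgX').1 hg
      have hΓgX : Γ.toMulEquiv g ∉ Mβ.inclX.range := by
        intro h
        rw [← hX] at h
        obtain ⟨g', hg', hgg'⟩ := h
        have : g' = g := Γ.toMulEquiv.injective hgg'
        rw [this] at hg'
        exact hgX' hg'
      exact (hcβ _ hΓgX).2 fun h => hnP (hP g h)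
  -- equality by index
  have hidx : ((Mα.dotC εα).map Γ.toMulEquiv.toMonoidHom).index = 2 := by
    rw [Subgroup.index_map_of_injective _ Γ.toMulEquiv.injective, Mα.index_dotC hα,
      MonoidHom.range_eq_top.2 Γ.toMulEquiv.surjective, Subgroup.index_top, mul_one]
  have h := Subgroup.relIndex_mul_index hle
  rw [hidx, Mβ.index_dotC hβ] at h
  have h1 : ((Mα.dotC εα).map Γ.toMulEquiv.toMonoidHom).relIndex (Mβ.dotC εβ) = 1 := by omega
  exact le_antisymm hle (Subgroup.relIndex_eq_one.1 h1)

/-- **Prop. 1.8, the `Ẋ`-case, with the cusp characterisation intrinsic** (pp. 28–29): `Prop18` holds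
given (a) an extension `Γ` of `γ : Π^tp_{Ẋα} →̃ Π^tp_{Ẋβ}` up to an inner automorphism ([SemiAnbd] Thm.
6.8 (ii) + condition (II)), (b) an induced `γX : Π^tp_{Xα} →̃ Π^tp_{Xβ}` ([AbsCusp] Lem. 2.1 (v)),
(c′) on each side print's characterisation "`Ẋ → Ċ` is the quotient by the unique automorphism of `Ẋ`
over `C` that acts nontrivially on the cusps of `Ẋ` but does not lie over `X`" — an element of `Π^tp_C`
not over `X` lies in `Π^tp_Ċ` iff it acts NONtrivially on the cusps of `Ẋ` — together with [SemiAnbd]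
Thm. 6.5 (iii) for `(Xα, Xβ)` (the named fact `TemperedCurve.IsoPreservesCuspidalDecomp`), and
(d) Thm. 1.6 (i) for `γX`. [cite: MochizukiEtTh2009, Prop 1.8 p.28] -/
theorem prop18_of_cusps (hα : Mα.IsAdmissibleEpsZ εα) (hβ : Mβ.IsAdmissibleEpsZ εβ)
    (γ : Mα.dotX εα ≃ₜ* Mβ.dotX εβ) (Γ : Mα.GtpC ≃ₜ* Mβ.GtpC)
    (hres : ∃ c : Mβ.GtpC, ∀ x : Mα.dotX εα, Γ.toMulEquiv x.1 = c * (γ.toMulEquiv x).1 * c⁻¹)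
    (γX : Mα.PiTemp ≃ₜ* Mβ.PiTemp)
    (hγX : ∀ x, Mβ.inclX (γX.toMulEquiv x) = Γ.toMulEquiv (Mα.inclX x))
    (h16 : ThetaSetting.Thm16i γX)
    (hcusp : TemperedCurve.IsoPreservesCuspidalDecomp Mα.toTemperedCurve Mβ.toTemperedCurve)
    (hcα : ∀ g : Mα.GtpC, g ∉ Mα.inclX.range → (g ∈ Mα.dotC εα ↔
      ¬ ∀ D : Subgroup Mα.PiTemp, Mα.IsCuspidalDecompositionGroup D →
        ∃ h ∈ Mα.dotX εα,
          ((D ⊓ (Mα.dotX εα).comap Mα.inclX).map Mα.inclX).map (MulAut.conj g).toMonoidHom =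
            ((D ⊓ (Mα.dotX εα).comap Mα.inclX).map Mα.inclX).map (MulAut.conj h).toMonoidHom))
    (hcβ : ∀ g : Mβ.GtpC, g ∉ Mβ.inclX.range → (g ∈ Mβ.dotC εβ ↔
      ¬ ∀ D : Subgroup Mβ.PiTemp, Mβ.IsCuspidalDecompositionGroup D →
        ∃ h ∈ Mβ.dotX εβ,
          ((D ⊓ (Mβ.dotX εβ).comap Mβ.inclX).map Mβ.inclX).map (MulAut.conj g).toMonoidHom =
            ((D ⊓ (Mβ.dotX εβ).comap Mβ.inclX).map Mβ.inclX).map (MulAut.conj h).toMonoidHom)) :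
    Prop18 hα hβ γ := by
  have hdotX : (Mα.dotX εα).map Γ.toMulEquiv.toMonoidHom = Mβ.dotX εβ :=
    map_dotX_eq_of_extension γ Γ hres
  have hX := map_range_inclX_eq Γ γX hγX
  have hC : (Mα.dotC εα).map Γ.toMulEquiv.toMonoidHom = Mβ.dotC εβ :=
    map_dotC_eq_of_separating hα hβ Γ hX hdotX _ _
      (fun g hg => fixesCuspsOfDotX_of_map Γ γX hγX hdotX hcusp g hg) hcα hcβ
  exact prop18_of_extension hα hβ γ Γ hres γX hγX h16 hC

end Prop18Cusps

end Literature.AnabelianGeometry.EtaleTheta
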